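import Literature.Probability.FitznerVanDerHofstad2017.NobleJointTwoLevel
import Literature.Probability.FitznerVanDerHofstad2017.NobleRerouteClassOneBond
import Literature.Probability.FitznerVanDerHofstad2017.NobleBoundsN1Classes
import HarnessLib

/-!
# [FvdH17] §6.1, classes `a = 1` / `b = 1` INSIDE the joint two-level event: re-routing the witnesses of
`jointWit` onto the open class-`1` bond

Source: R. Fitzner, R. van der Hofstad, *Mean-field behavior for nearest-neighbor percolation in `d > 10`*,
Electron. J. Probab. **22** (2017) no. 43 [FvdH17] (arXiv:1506.07977v2; equation numbers agree).  §6.1,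
v2 p. 58, before (6.7): "(ii.) If the double connection is achieved by one direct bond and another disjoint
connection."; v2 p. 59, after (6.14): "When `a = 1` and/or `b = 1`, we include the information that `u, w`
and/or `z, t` are neighbors into the definition of `Ā`, see Figure 12."  §4.4, v2 p. 43, after (4.65): "the
bonds used at level `i − 1` to connect to `z_i ∈ C̃_{i−1}` cannot be used again at level `i`, as the connections
at level `i` are required to avoid `C̃_{i−1}`".

## What this file proves (deterministic; no named fact, no numeral, no dimension)

`NobleJointTwoLevel.jointWit b₀ w z t x` (carver, X1-j2) is the joint bounding event of (4.65) for `N = 1`: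
bond-disjoint witnesses `K₀ i ⊆ ω₀ ∖ {b₀}` of the level-`0` lines `{0↔u}, {0↔w}, {w↔u}, {w↔z}` and
`K₁ i ⊆ (ω₁)_{B(u)ᶜ}` of the level-`1` lines `{v↔t}, {t↔z}, {t↔x}, {z↔x}` (`b₀ = (u,v)`), the witnesses of
`{v↔t}, {t↔z}` off every level-`0` witness, and for `z ≠ t` the bond `(t,z)` off every level-`0` witness.
The classes of §6.1 are read off the configuration: `a = 1` iff `w ≠ u` and the bond `(u,w)` is open at
level `0`; `b = 1` iff `z ≠ t` and the bond `(t,z)` is open at level `1`.  In a class-`1` configuration the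
witness of the class-`1` line need NOT be that bond; the block tables of §6.1 / App. B (letters `𝓣_{1,1̲,0}`,
`𝓢_{0,1̲,1̲,0}`, the factor `2dD(u−w)`, the `p⁻¹` of `Ā^{ι,a,1}`) presuppose that it IS.  Using the purely
combinatorial re-routing `NobleRerouteClassOneBond.exists_reroute_openConn`, this file proves that the
witnesses CAN be so chosen while keeping every clause of `JointWitnessed`:

* `JointWitnessed.exists_reroute₁` — class `b = 1`: witnesses with `K₁ 1 = {(t,z)}` (the other three
  level-`1` witnesses then avoid the bond, by pairwise disjointness); the cross-level clause of the new
  `K₁ 1` is exactly the `(t,z)`-clause of `JointWitnessed`, and the new `K₁ 0 ⊆ K₁ 0 ∪ K₁ 1` keeps its own;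
* `JointWitnessed.exists_reroute₀` — class `a = 1`: witnesses with `K₀ 2 = {(u,w)}`; the cross-level clauses
  survive because `(u,w) ∈ B(u)` is never in a level-`1` witness, and the `(t,z)`-clause because
  `(t,z) ≠ (u,w)` (`t, z ≠ u`);
* `JointWitnessed.exists_reroute₀₁` — both at once (`a = b = 1`);
* the event forms `exists_reroute₁_of_mem_jointWit`, `exists_reroute₀_of_mem_jointWit`,
  `exists_reroute₀₁_of_mem_jointWit` for `ω ∈ jointWit b₀ w z t x`, where the side conditions `JWSide`
  (`t, z, x ≠ u`, `w ≠ v`) discharge the bookkeeping (`mem_offBonds_bondsAt_of_ne`,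
  `mem_offBonds_singleton_of_ne`, `not_mem_offBonds_bondsAt_self`, `sym2_ne_of_ne`);
* the tuple forms `reroute₁_core`, `reroute₀_core` with the containments of the new witnesses in the old
  ones (`∪` the bond), for consumers that track where the witnesses lie;
* the class forms `exists_reroute₁_of_mem_cls` (`jointWit ∩ clsSet u w t z a 1`), `exists_reroute₀_of_mem_cls`
  (`clsSet u w t z 1 b`), `exists_reroute₀₁_of_mem_cls` (`clsSet u w t z 1 1`) over `NobleBoundsN1Classes.clsSet`;
* the hand-over to the grouped BK inequality with the lines left FREE: `mem_genDisjOccGrouped_of_tuple(')`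
  (= `jointWit_subset_genDisjOccGrouped` for an arbitrary line family containing the tuple, so a class feeds its
  UPGRADED lines — exact length `1` for the bond, `≥ 2` / `≥ 3` for the others) and the generic two-level form
  `mem_genDisjOccGrouped_twoLevel` (arbitrary index types `ι₀ ⊕ ι₁`, for tuples extended by absorbed bond lines),
  with the singleton bookkeeping `not_mem_of_subset_offBonds_singleton/bondsAt`, `disjoint_singleton_of_not_mem`.

These are the inputs of the class-`(a,1)`, `(1,b)` cases of the bound (6.9)–(6.14) (DAG node N76-X1,
X1-case(a,b)); which grouping and which letters is NOT done here.  [folklore] combinatorics throughout.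
-/

namespace Literature.Probability.FitznerVanDerHofstad2017

open Literature.Barriers.CriticalPhenomena Literature.Probability.Percolation
open Literature.Probability.LatticeModels Literature.Combinatorics.SimpleGraph _root_.SimpleGraph

variable {d : ℕ}

/-! ### Level 1 (class `b = 1`): the line `{t ↔ z}` re-routed onto the open bond `(t,z)` -/

/-- **Re-routing the level-`1` witnesses onto the open bond `(t,z)`, tuple form.** If the four level-`1`
lines `{v↔t}, {t↔z}, {t↔x}, {z↔x}` have pairwise bond-disjoint witnesses `K₁ i ⊆ β`, the witnesses of
`{v↔t}` and `{t↔z}` are bond-disjoint from the level-`0` witnesses `K₀ j`, the bond `(t,z)` is off every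
`K₀ j`, and `(t,z) ∈ β` is open (`z ≠ t`), then there are new level-`1` witnesses with the SAME properties in
which `{t↔z}` is witnessed by the single bond `{(t,z)}` and the other three avoid that bond; the new witness of
`{v↔t}` lies inside the old witnesses of `{v↔t}, {t↔z}`, and every new witness inside the old ones `∪ {(t,z)}`.
(The combinatorics is `exists_reroute_openConn`; this is the form consumed by the class-`(a,1)` cases of
[FvdH17] §6.1, where "`z` and `t` are neighbors" (arXiv:1506.07977v2 p. 59) and the line `{t↔z}` of the
bounding event is the bond.) [folklore] -/
theorem reroute₁_core {z v t x : Site d} {β : BondConfig (Site d)}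
    {K₀ K₁ : Fin 4 → Set (Sym2 (Site d))}
    (h₁ : ∀ i, K₁ i ⊆ β) (hA₁ : ∀ i, K₁ i ∈ jwLines₁ v t z x i)
    (hd₁ : Pairwise fun i j => Disjoint (K₁ i) (K₁ j))
    (hc₀ : ∀ j, Disjoint (K₁ 0) (K₀ j)) (hc₁ : ∀ j, Disjoint (K₁ 1) (K₀ j))
    (hbd : ∀ j, s(t, z) ∉ K₀ j) (hzt : z ≠ t) (hb : s(t, z) ∈ β) :
    ∃ K₁' : Fin 4 → Set (Sym2 (Site d)),
      (∀ i, K₁' i ⊆ β) ∧ (∀ i, K₁' i ∈ jwLines₁ v t z x i) ∧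
      (Pairwise fun i j => Disjoint (K₁' i) (K₁' j)) ∧
      (∀ j, Disjoint (K₁' 0) (K₀ j)) ∧ (∀ j, Disjoint (K₁' 1) (K₀ j)) ∧
      K₁' 1 = {s(t, z)} ∧ K₁' 0 ⊆ K₁ 0 ∪ K₁ 1 ∧
      (∀ i, K₁' i ⊆ K₁ 0 ∪ K₁ 1 ∪ K₁ 2 ∪ K₁ 3 ∪ {s(t, z)}) := by
  have e0 : K₁ 0 ∈ (openConn v t : Set (BondConfig (Site d))) := hA₁ 0
  have e1 : K₁ 1 ∈ (openConn t z : Set (BondConfig (Site d))) := hA₁ 1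
  have e2 : K₁ 2 ∈ (openConn t x : Set (BondConfig (Site d))) := hA₁ 2
  have e3 : K₁ 3 ∈ (openConn z x : Set (BondConfig (Site d))) := hA₁ 3
  have e0' : K₁ 0 ∈ (openConn t v : Set (BondConfig (Site d))) :=
    show (openGraph (K₁ 0)).Reachable t v from SimpleGraph.Reachable.symm e0
  have e2' : K₁ 2 ∈ (openConn x t : Set (BondConfig (Site d))) :=
    show (openGraph (K₁ 2)).Reachable x t from SimpleGraph.Reachable.symm e2
  have e3' : K₁ 3 ∈ (openConn x z : Set (BondConfig (Site d))) :=
    show (openGraph (K₁ 3)).Reachable x z from SimpleGraph.Reachable.symm e3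
  have n : ∀ {i j : Fin 4}, i ≠ j → Disjoint (K₁ i) (K₁ j) := fun hij => hd₁ hij
  obtain ⟨A, B, C, hAsub, hBsub, hCsub, -, hA, hB, hC, hsA, hsB, hsC, dAB, dAC, dBC⟩ :=
    exists_reroute_openConn (o := x) (u := z) (w := t) (z := v) e3' e2' e1 e0'
      (n (by decide)) (n (by decide)) (n (by decide)) (n (by decide)) (n (by decide)) (n (by decide))
  have hC' : C ∈ (openConn v t : Set (BondConfig (Site d))) :=
    show (openGraph C).Reachable v t from SimpleGraph.Reachable.symm hC
  have hB' : B ∈ (openConn t x : Set (BondConfig (Site d))) :=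
    show (openGraph B).Reachable t x from SimpleGraph.Reachable.symm hB
  have hA' : A ∈ (openConn z x : Set (BondConfig (Site d))) :=
    show (openGraph A).Reachable z x from SimpleGraph.Reachable.symm hA
  have hS : ({s(t, z)} : Set (Sym2 (Site d))) ∈ (openConn t z : Set (BondConfig (Site d))) :=
    singleton_mem_openConn (Ne.symm hzt)
  -- the big container and the memberships in it
  -- the container `U := K₁ 0 ∪ K₁ 1 ∪ K₁ 2 ∪ K₁ 3 ∪ {(t,z)}` and the memberships in it
  have m0 : K₁ 0 ⊆ K₁ 0 ∪ K₁ 1 ∪ K₁ 2 ∪ K₁ 3 ∪ {s(t, z)} := fun e he => Or.inl (Or.inl (Or.inl (Or.inl he)))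
  have m1 : K₁ 1 ⊆ K₁ 0 ∪ K₁ 1 ∪ K₁ 2 ∪ K₁ 3 ∪ {s(t, z)} := fun e he => Or.inl (Or.inl (Or.inl (Or.inr he)))
  have m2 : K₁ 2 ⊆ K₁ 0 ∪ K₁ 1 ∪ K₁ 2 ∪ K₁ 3 ∪ {s(t, z)} := fun e he => Or.inl (Or.inl (Or.inr he))
  have m3 : K₁ 3 ⊆ K₁ 0 ∪ K₁ 1 ∪ K₁ 2 ∪ K₁ 3 ∪ {s(t, z)} := fun e he => Or.inl (Or.inr he)
  have ms : ({s(t, z)} : Set (Sym2 (Site d))) ⊆ K₁ 0 ∪ K₁ 1 ∪ K₁ 2 ∪ K₁ 3 ∪ {s(t, z)} := fun e he => Or.inr he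
  have hCU : C ⊆ K₁ 0 ∪ K₁ 1 ∪ K₁ 2 ∪ K₁ 3 ∪ {s(t, z)} := fun e he =>
    (hCsub he).elim (fun h => m0 h) (fun h => m1 h)
  have hBU : B ⊆ K₁ 0 ∪ K₁ 1 ∪ K₁ 2 ∪ K₁ 3 ∪ {s(t, z)} := fun e he =>
    (hBsub he).elim (fun h => h.elim (fun h => m3 h) (fun h => m2 h)) (fun h => m1 h)
  have hAU : A ⊆ K₁ 0 ∪ K₁ 1 ∪ K₁ 2 ∪ K₁ 3 ∪ {s(t, z)} := fun e he =>
    (hAsub he).elim (fun h => h.elim (fun h => m3 h) (fun h => m2 h)) (fun h => m1 h)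
  have hUβ' : K₁ 0 ∪ K₁ 1 ∪ K₁ 2 ∪ K₁ 3 ∪ {s(t, z)} ⊆ β :=
    Set.union_subset (Set.union_subset (Set.union_subset (Set.union_subset (h₁ 0) (h₁ 1)) (h₁ 2)) (h₁ 3))
      (Set.singleton_subset_iff.2 hb)
  refine ⟨![C, {s(t, z)}, B, A], ?_, ?_, ?_, ?_, ?_, rfl, hCsub, ?_⟩
  · exact forall_fin_four.2 ⟨hCU.trans hUβ', ms.trans hUβ', hBU.trans hUβ', hAU.trans hUβ'⟩
  · exact forall_fin_four.2 ⟨hC', hS, hB', hA'⟩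
  · exact pairwise_disjoint_vec4 (Set.disjoint_singleton_right.2 hsC) dBC.symm dAC.symm
      (Set.disjoint_singleton_left.2 hsB) (Set.disjoint_singleton_left.2 hsA) dAB.symm
  · intro j
    exact Disjoint.mono_left hCsub (Set.disjoint_union_left.2 ⟨hc₀ j, hc₁ j⟩)
  · intro j
    exact Set.disjoint_singleton_left.2 (hbd j)
  · exact forall_fin_four.2 ⟨hCU, ms, hBU, hAU⟩

/-! ### Level 0 (class `a = 1`): the line `{w ↔ u}` re-routed onto the open bond `(u,w)` -/

/-- **Re-routing the level-`0` witnesses onto the open bond `(u,w)`, tuple form** (`u = b̲₀`). If the four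
level-`0` lines `{0↔u}, {0↔w}, {w↔u}, {w↔z}` have pairwise bond-disjoint witnesses `K₀ i ⊆ α`, the bond `(u,w)`
(`w ≠ u`) is open in `α` and off the two level-`1` witnesses `K₁ 0, K₁ 1`, and differs from `(t,z)`, then there
are new level-`0` witnesses with the SAME properties (incl. the cross-level clauses and the `(t,z)`-clause) in
which `{w↔u}` is witnessed by the single bond `{(u,w)}` and the other three avoid it; the new witness of `{w↔z}`
lies inside the old witnesses of `{w↔z}, {w↔u}`, and inside the old witness of `{w↔z}` alone when that one
avoids `(u,w)`.
("`u` and `w` are neighbors", arXiv:1506.07977v2 p. 59, Case `a = 1`.) [folklore] -/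
theorem reroute₀_core {u w z t : Site d} {α : BondConfig (Site d)}
    {K₀ K₁ : Fin 4 → Set (Sym2 (Site d))}
    (h₀ : ∀ i, K₀ i ⊆ α) (hA₀ : ∀ i, K₀ i ∈ jwLines₀ u w z i)
    (hd₀ : Pairwise fun i j => Disjoint (K₀ i) (K₀ j))
    (hc₀ : ∀ j, Disjoint (K₁ 0) (K₀ j)) (hc₁ : ∀ j, Disjoint (K₁ 1) (K₀ j))
    (hbd : z ≠ t → ∀ j, s(t, z) ∉ K₀ j)
    (hwu : w ≠ u) (hb : s(u, w) ∈ α) (hβ₀ : s(u, w) ∉ K₁ 0) (hβ₁ : s(u, w) ∉ K₁ 1)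
    (hne : s(t, z) ≠ s(u, w)) :
    ∃ K₀' : Fin 4 → Set (Sym2 (Site d)),
      (∀ i, K₀' i ⊆ α) ∧ (∀ i, K₀' i ∈ jwLines₀ u w z i) ∧
      (Pairwise fun i j => Disjoint (K₀' i) (K₀' j)) ∧
      (∀ j, Disjoint (K₁ 0) (K₀' j)) ∧ (∀ j, Disjoint (K₁ 1) (K₀' j)) ∧
      (z ≠ t → ∀ j, s(t, z) ∉ K₀' j) ∧
      K₀' 2 = {s(u, w)} ∧ (s(u, w) ∉ K₀ 3 → K₀' 3 ⊆ K₀ 3) ∧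
      (∀ i, K₀' i ⊆ K₀ 0 ∪ K₀ 1 ∪ K₀ 2 ∪ K₀ 3 ∪ {s(u, w)}) := by
  have hsw : s(w, u) = s(u, w) := Sym2.eq_swap
  have e0 : K₀ 0 ∈ (openConn 0 u : Set (BondConfig (Site d))) := hA₀ 0
  have e1 : K₀ 1 ∈ (openConn 0 w : Set (BondConfig (Site d))) := hA₀ 1
  have e2 : K₀ 2 ∈ (openConn w u : Set (BondConfig (Site d))) := hA₀ 2
  have e3 : K₀ 3 ∈ (openConn w z : Set (BondConfig (Site d))) := hA₀ 3
  have n : ∀ {i j : Fin 4}, i ≠ j → Disjoint (K₀ i) (K₀ j) := fun hij => hd₀ hij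
  obtain ⟨A, B, C, hAsub, hBsub, hCsub, hC3, hA, hB, hC, hsA, hsB, hsC, dAB, dAC, dBC⟩ :=
    exists_reroute_openConn (o := (0 : Site d)) (u := u) (w := w) (z := z) e0 e1 e2 e3
      (n (by decide)) (n (by decide)) (n (by decide)) (n (by decide)) (n (by decide)) (n (by decide))
  rw [hsw] at hsA hsB hsC hC3
  have hS : ({s(u, w)} : Set (Sym2 (Site d))) ∈ (openConn w u : Set (BondConfig (Site d))) := by
    rw [← hsw]; exact singleton_mem_openConn hwu
  -- the container `U := K₀ 0 ∪ K₀ 1 ∪ K₀ 2 ∪ K₀ 3 ∪ {(u,w)}` and the memberships in it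
  have m0 : K₀ 0 ⊆ K₀ 0 ∪ K₀ 1 ∪ K₀ 2 ∪ K₀ 3 ∪ {s(u, w)} := fun e he => Or.inl (Or.inl (Or.inl (Or.inl he)))
  have m1 : K₀ 1 ⊆ K₀ 0 ∪ K₀ 1 ∪ K₀ 2 ∪ K₀ 3 ∪ {s(u, w)} := fun e he => Or.inl (Or.inl (Or.inl (Or.inr he)))
  have m2 : K₀ 2 ⊆ K₀ 0 ∪ K₀ 1 ∪ K₀ 2 ∪ K₀ 3 ∪ {s(u, w)} := fun e he => Or.inl (Or.inl (Or.inr he))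
  have m3 : K₀ 3 ⊆ K₀ 0 ∪ K₀ 1 ∪ K₀ 2 ∪ K₀ 3 ∪ {s(u, w)} := fun e he => Or.inl (Or.inr he)
  have ms : ({s(u, w)} : Set (Sym2 (Site d))) ⊆ K₀ 0 ∪ K₀ 1 ∪ K₀ 2 ∪ K₀ 3 ∪ {s(u, w)} := fun e he => Or.inr he
  have hAU : A ⊆ K₀ 0 ∪ K₀ 1 ∪ K₀ 2 ∪ K₀ 3 ∪ {s(u, w)} := fun e he =>
    (hAsub he).elim (fun h => h.elim (fun h => m0 h) (fun h => m1 h)) (fun h => m2 h)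
  have hBU : B ⊆ K₀ 0 ∪ K₀ 1 ∪ K₀ 2 ∪ K₀ 3 ∪ {s(u, w)} := fun e he =>
    (hBsub he).elim (fun h => h.elim (fun h => m0 h) (fun h => m1 h)) (fun h => m2 h)
  have hCU : C ⊆ K₀ 0 ∪ K₀ 1 ∪ K₀ 2 ∪ K₀ 3 ∪ {s(u, w)} := fun e he =>
    (hCsub he).elim (fun h => m3 h) (fun h => m2 h)
  have hUα' : K₀ 0 ∪ K₀ 1 ∪ K₀ 2 ∪ K₀ 3 ∪ {s(u, w)} ⊆ α :=
    Set.union_subset (Set.union_subset (Set.union_subset (Set.union_subset (h₀ 0) (h₀ 1)) (h₀ 2)) (h₀ 3))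
      (Set.singleton_subset_iff.2 hb)
  -- the level-1 witnesses `K₁ 0`, `K₁ 1` and (for `z ≠ t`) the bond `(t,z)` are off the container
  have hK : ∀ {L : Set (Sym2 (Site d))}, (∀ j, Disjoint L (K₀ j)) → s(u, w) ∉ L →
      Disjoint L (K₀ 0 ∪ K₀ 1 ∪ K₀ 2 ∪ K₀ 3 ∪ {s(u, w)}) := by
    intro L hL hs
    refine Set.disjoint_union_right.2 ⟨?_, Set.disjoint_singleton_right.2 hs⟩
    exact Set.disjoint_union_right.2 ⟨Set.disjoint_union_right.2
      ⟨Set.disjoint_union_right.2 ⟨hL 0, hL 1⟩, hL 2⟩, hL 3⟩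
  have hTZ : z ≠ t → s(t, z) ∉ K₀ 0 ∪ K₀ 1 ∪ K₀ 2 ∪ K₀ 3 ∪ {s(u, w)} := by
    intro hzt hmem
    rcases hmem with ((((h | h) | h) | h) | h)
    · exact hbd hzt 0 h
    · exact hbd hzt 1 h
    · exact hbd hzt 2 h
    · exact hbd hzt 3 h
    · exact hne h
  refine ⟨![A, B, {s(u, w)}, C], ?_, ?_, ?_, ?_, ?_, ?_, rfl, hC3, ?_⟩
  · exact forall_fin_four.2 ⟨hAU.trans hUα', hBU.trans hUα', ms.trans hUα', hCU.trans hUα'⟩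
  · exact forall_fin_four.2 ⟨hA, hB, hS, hC⟩
  · exact pairwise_disjoint_vec4 dAB (Set.disjoint_singleton_right.2 hsA) dAC
      (Set.disjoint_singleton_right.2 hsB) dBC (Set.disjoint_singleton_left.2 hsC)
  · have h := hK hc₀ hβ₀
    exact forall_fin_four.2 ⟨h.mono_right hAU, h.mono_right hBU, h.mono_right ms, h.mono_right hCU⟩
  · have h := hK hc₁ hβ₁
    exact forall_fin_four.2 ⟨h.mono_right hAU, h.mono_right hBU, h.mono_right ms, h.mono_right hCU⟩
  · intro hzt
    have h := hTZ hzt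
    exact forall_fin_four.2 ⟨fun hm => h (hAU hm), fun hm => h (hBU hm), fun hm => h (ms hm), fun hm => h (hCU hm)⟩
  · exact forall_fin_four.2 ⟨hAU, hBU, ms, hCU⟩

/-! ### The same at the level of `JointWitnessed` / `jointWit` -/

/-- **Class `b = 1` re-routing of the joint witness predicate**: if `(t,z) ∈ β` is open (`z ≠ t`), the
witnesses may be chosen with `K₁ 1 = {(t,z)}` — the line `{t↔z}` IS the bond and the other level-`1`
witnesses avoid it. [folklore] -/
theorem JointWitnessed.exists_reroute₁ {u w z v t x : Site d} {α β : BondConfig (Site d)}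
    (h : JointWitnessed u w z v t x α β) (hzt : z ≠ t) (hb : s(t, z) ∈ β) :
    ∃ K₀ K₁ : Fin 4 → Set (Sym2 (Site d)),
      (∀ i, K₀ i ⊆ α) ∧ (∀ i, K₁ i ⊆ β) ∧ (∀ i, K₀ i ∈ jwLines₀ u w z i) ∧ (∀ i, K₁ i ∈ jwLines₁ v t z x i) ∧
      (Pairwise fun i j => Disjoint (K₀ i) (K₀ j)) ∧ (Pairwise fun i j => Disjoint (K₁ i) (K₁ j)) ∧
      (∀ j, Disjoint (K₁ 0) (K₀ j)) ∧ (∀ j, Disjoint (K₁ 1) (K₀ j)) ∧ (z ≠ t → ∀ j, s(t, z) ∉ K₀ j) ∧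
      K₁ 1 = {s(t, z)} := by
  obtain ⟨K₀, K₁, h₀, h₁, hA₀, hA₁, hd₀, hd₁, hc₀, hc₁, hbd⟩ := h
  obtain ⟨K₁', h₁', hA₁', hd₁', hc₀', hc₁', hEq, -, -⟩ := reroute₁_core h₁ hA₁ hd₁ hc₀ hc₁ (hbd hzt) hzt hb
  exact ⟨K₀, K₁', h₀, h₁', hA₀, hA₁', hd₀, hd₁', hc₀', hc₁', hbd, hEq⟩

/-- **Class `a = 1` re-routing of the joint witness predicate**: if `(u,w) ∈ α` is open (`w ≠ u`), off `β`,
and differs from `(t,z)`, the witnesses may be chosen with `K₀ 2 = {(u,w)}` — the line `{w↔u}` IS the bond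
and the other level-`0` witnesses avoid it. [folklore] -/
theorem JointWitnessed.exists_reroute₀ {u w z v t x : Site d} {α β : BondConfig (Site d)}
    (h : JointWitnessed u w z v t x α β) (hwu : w ≠ u) (hb : s(u, w) ∈ α) (hβ : s(u, w) ∉ β)
    (hne : s(t, z) ≠ s(u, w)) :
    ∃ K₀ K₁ : Fin 4 → Set (Sym2 (Site d)),
      (∀ i, K₀ i ⊆ α) ∧ (∀ i, K₁ i ⊆ β) ∧ (∀ i, K₀ i ∈ jwLines₀ u w z i) ∧ (∀ i, K₁ i ∈ jwLines₁ v t z x i) ∧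
      (Pairwise fun i j => Disjoint (K₀ i) (K₀ j)) ∧ (Pairwise fun i j => Disjoint (K₁ i) (K₁ j)) ∧
      (∀ j, Disjoint (K₁ 0) (K₀ j)) ∧ (∀ j, Disjoint (K₁ 1) (K₀ j)) ∧ (z ≠ t → ∀ j, s(t, z) ∉ K₀ j) ∧
      K₀ 2 = {s(u, w)} := by
  obtain ⟨K₀, K₁, h₀, h₁, hA₀, hA₁, hd₀, hd₁, hc₀, hc₁, hbd⟩ := h
  obtain ⟨K₀', h₀', hA₀', hd₀', hc₀', hc₁', hbd', hEq, -, -⟩ :=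
    reroute₀_core h₀ hA₀ hd₀ hc₀ hc₁ hbd hwu hb (fun hm => hβ (h₁ 0 hm)) (fun hm => hβ (h₁ 1 hm)) hne
  exact ⟨K₀', K₁, h₀', h₁, hA₀', hA₁, hd₀', hd₁, hc₀', hc₁', hbd', hEq⟩

/-- **Class `a = b = 1`**: both re-routings at once (`K₀ 2 = {(u,w)}` and `K₁ 1 = {(t,z)}`); here
`(t,z) ≠ (u,w)` is automatic (`(t,z) ∈ β ∌ (u,w)`). [folklore] -/
theorem JointWitnessed.exists_reroute₀₁ {u w z v t x : Site d} {α β : BondConfig (Site d)}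
    (h : JointWitnessed u w z v t x α β) (hwu : w ≠ u) (hb₀ : s(u, w) ∈ α) (hβ : s(u, w) ∉ β)
    (hzt : z ≠ t) (hb₁ : s(t, z) ∈ β) :
    ∃ K₀ K₁ : Fin 4 → Set (Sym2 (Site d)),
      (∀ i, K₀ i ⊆ α) ∧ (∀ i, K₁ i ⊆ β) ∧ (∀ i, K₀ i ∈ jwLines₀ u w z i) ∧ (∀ i, K₁ i ∈ jwLines₁ v t z x i) ∧
      (Pairwise fun i j => Disjoint (K₀ i) (K₀ j)) ∧ (Pairwise fun i j => Disjoint (K₁ i) (K₁ j)) ∧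
      (∀ j, Disjoint (K₁ 0) (K₀ j)) ∧ (∀ j, Disjoint (K₁ 1) (K₀ j)) ∧ (z ≠ t → ∀ j, s(t, z) ∉ K₀ j) ∧
      K₀ 2 = {s(u, w)} ∧ K₁ 1 = {s(t, z)} := by
  have hne : s(t, z) ≠ s(u, w) := fun he => hβ (he ▸ hb₁)
  obtain ⟨K₀, K₁, h₀, h₁, hA₀, hA₁, hd₀, hd₁, hc₀, hc₁, hbd, hEq₁⟩ := h.exists_reroute₁ hzt hb₁
  obtain ⟨K₀', h₀', hA₀', hd₀', hc₀', hc₁', hbd', hEq₀, -, -⟩ :=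
    reroute₀_core h₀ hA₀ hd₀ hc₀ hc₁ hbd hwu hb₀ (fun hm => hβ (h₁ 0 hm)) (fun hm => hβ (h₁ 1 hm)) hne
  exact ⟨K₀', K₁, h₀', h₁, hA₀', hA₁, hd₀', hd₁, hc₀', hc₁', hbd', hEq₀, hEq₁⟩

/-- In the joint event the bond `(t,z)` of level `1` is automatically off `B(u)` (`t, z ≠ u`). [folklore] -/
theorem mem_offBonds_bondsAt_of_ne {u t z : Site d} {ω : BondConfig (Site d)} (htu : t ≠ u) (hzu : z ≠ u)
    (hb : s(t, z) ∈ ω) : s(t, z) ∈ offBonds (bondsAt {u}) ω := by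
  refine ⟨hb, fun hm => ?_⟩
  rw [mem_bondsAt_singleton_iff, Sym2.mem_iff] at hm
  rcases hm with h | h
  · exact htu h.symm
  · exact hzu h.symm

/-- In the joint event the bond `(u,w)` of level `0` is automatically off `{b₀}` (`w ≠ v`) … [folklore] -/
theorem mem_offBonds_singleton_of_ne {u v w : Site d} {ω : BondConfig (Site d)} (hwv : w ≠ v)
    (hb : s(u, w) ∈ ω) : s(u, w) ∈ offBonds {s(u, v)} ω := by
  refine ⟨hb, fun hm => ?_⟩
  rw [Set.mem_singleton_iff, Sym2.congr_right] at hm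
  exact hwv hm

/-- … and never in a configuration off `B(u)`. [folklore] -/
theorem not_mem_offBonds_bondsAt_self (u w : Site d) (ω : BondConfig (Site d)) :
    s(u, w) ∉ offBonds (bondsAt {u}) ω := fun hm =>
  hm.2 ((mem_bondsAt_singleton_iff u _).2 (Sym2.mem_mk_left u w))

/-- `(t,z) ≠ (u,w)` when `t, z ≠ u`. [folklore] -/
theorem sym2_ne_of_ne {u w t z : Site d} (htu : t ≠ u) (hzu : z ≠ u) : s(t, z) ≠ s(u, w) := by
  intro he
  have hu : u ∈ s(t, z) := by rw [he]; exact Sym2.mem_mk_left u w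
  rcases Sym2.mem_iff.1 hu with h | h
  · exact htu h.symm
  · exact hzu h.symm

/-- **Class `b = 1` re-routing inside the joint two-level event**: for `ω ∈ jointWit b₀ w z t x` with
`z ≠ t` and the bond `(t,z)` open at level `1`, the witnesses may be chosen with `K₁ 1 = {(t,z)}`.
[folklore] -/
theorem exists_reroute₁_of_mem_jointWit {u v w z t x : Site d} {ω : Fin 2 → BondConfig (Site d)}
    (h : ω ∈ jointWit u v w z t x) (hzt : z ≠ t) (hb : s(t, z) ∈ ω 1) :
    ∃ K₀ K₁ : Fin 4 → Set (Sym2 (Site d)),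
      (∀ i, K₀ i ⊆ offBonds {s(u, v)} (ω 0)) ∧ (∀ i, K₁ i ⊆ offBonds (bondsAt {u}) (ω 1)) ∧
      (∀ i, K₀ i ∈ jwLines₀ u w z i) ∧ (∀ i, K₁ i ∈ jwLines₁ v t z x i) ∧
      (Pairwise fun i j => Disjoint (K₀ i) (K₀ j)) ∧ (Pairwise fun i j => Disjoint (K₁ i) (K₁ j)) ∧
      (∀ j, Disjoint (K₁ 0) (K₀ j)) ∧ (∀ j, Disjoint (K₁ 1) (K₀ j)) ∧ (z ≠ t → ∀ j, s(t, z) ∉ K₀ j) ∧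
      K₁ 1 = {s(t, z)} := by
  obtain ⟨⟨-, -, -, -, htu, hzu, -⟩, hJ⟩ := h
  exact hJ.exists_reroute₁ hzt (mem_offBonds_bondsAt_of_ne htu hzu hb)

/-- **Class `a = 1` re-routing inside the joint two-level event**: for `ω ∈ jointWit b₀ w z t x` with
`w ≠ u = b̲₀` and the bond `(u,w)` open at level `0`, the witnesses may be chosen with `K₀ 2 = {(u,w)}`.
[folklore] -/
theorem exists_reroute₀_of_mem_jointWit {u v w z t x : Site d} {ω : Fin 2 → BondConfig (Site d)}
    (h : ω ∈ jointWit u v w z t x) (hwu : w ≠ u) (hb : s(u, w) ∈ ω 0) :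
    ∃ K₀ K₁ : Fin 4 → Set (Sym2 (Site d)),
      (∀ i, K₀ i ⊆ offBonds {s(u, v)} (ω 0)) ∧ (∀ i, K₁ i ⊆ offBonds (bondsAt {u}) (ω 1)) ∧
      (∀ i, K₀ i ∈ jwLines₀ u w z i) ∧ (∀ i, K₁ i ∈ jwLines₁ v t z x i) ∧
      (Pairwise fun i j => Disjoint (K₀ i) (K₀ j)) ∧ (Pairwise fun i j => Disjoint (K₁ i) (K₁ j)) ∧
      (∀ j, Disjoint (K₁ 0) (K₀ j)) ∧ (∀ j, Disjoint (K₁ 1) (K₀ j)) ∧ (z ≠ t → ∀ j, s(t, z) ∉ K₀ j) ∧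
      K₀ 2 = {s(u, w)} := by
  obtain ⟨⟨-, -, hwv, -, htu, hzu, -⟩, hJ⟩ := h
  exact hJ.exists_reroute₀ hwu (mem_offBonds_singleton_of_ne hwv hb) (not_mem_offBonds_bondsAt_self u w _)
    (sym2_ne_of_ne htu hzu)

/-- **Classes `a = b = 1` inside the joint two-level event**: both re-routings at once. [folklore] -/
theorem exists_reroute₀₁_of_mem_jointWit {u v w z t x : Site d} {ω : Fin 2 → BondConfig (Site d)}
    (h : ω ∈ jointWit u v w z t x) (hwu : w ≠ u) (hb₀ : s(u, w) ∈ ω 0) (hzt : z ≠ t) (hb₁ : s(t, z) ∈ ω 1) :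
    ∃ K₀ K₁ : Fin 4 → Set (Sym2 (Site d)),
      (∀ i, K₀ i ⊆ offBonds {s(u, v)} (ω 0)) ∧ (∀ i, K₁ i ⊆ offBonds (bondsAt {u}) (ω 1)) ∧
      (∀ i, K₀ i ∈ jwLines₀ u w z i) ∧ (∀ i, K₁ i ∈ jwLines₁ v t z x i) ∧
      (Pairwise fun i j => Disjoint (K₀ i) (K₀ j)) ∧ (Pairwise fun i j => Disjoint (K₁ i) (K₁ j)) ∧
      (∀ j, Disjoint (K₁ 0) (K₀ j)) ∧ (∀ j, Disjoint (K₁ 1) (K₀ j)) ∧ (z ≠ t → ∀ j, s(t, z) ∉ K₀ j) ∧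
      K₀ 2 = {s(u, w)} ∧ K₁ 1 = {s(t, z)} := by
  obtain ⟨⟨-, -, hwv, -, htu, hzu, -⟩, hJ⟩ := h
  exact hJ.exists_reroute₀₁ hwu (mem_offBonds_singleton_of_ne hwv hb₀) (not_mem_offBonds_bondsAt_self u w _)
    hzt (mem_offBonds_bondsAt_of_ne htu hzu hb₁)


/-! ### From a witness tuple to the grouped labelled disjoint occurrence event of upgraded lines -/

/-- **Witness tuple ⇒ grouped event, for ANY eight lines the tuple witnesses.** If `K₀, K₁` satisfy the
disjointness clauses of `JointWitnessed` (pairwise on each level; `K₁ 0`, `K₁ 1` off every `K₀ j`) and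
`K₀ i ⊆ ω 0`, `K₁ i ⊆ ω 1`, then `ω` lies in the grouped labelled disjoint occurrence event
`⊛^{grp} (A_i)_{jwCfg i}` of every line family `A` with `Sum.elim K₀ K₁ i ∈ A i`, for every grouping `g` whose
cross-level groups contain on level `1` at most the lines `0` (`{v↔t}`) and `1` (`{t↔z}`).  This is
`NobleJointTwoLevel.jointWit_subset_genDisjOccGrouped` with the lines left free: a class-`(a,b)` case feeds it
the re-routed tuple and the UPGRADED lines of its class (`openConnEq 1` for the class-`1` bond,
`openConnGe 2`/`3` for the others, cf. `NoblePercLettersTransport` §E).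
[cite: FitznerVanDerHofstad2017, §4.2 Def. 4.1 and §6.1 (arXiv:1506.07977v2 pp. 35, 58–59)] -/
theorem mem_genDisjOccGrouped_of_tuple {γ : Type*} {ω : Fin 2 → BondConfig (Site d)}
    (A : Fin 4 ⊕ Fin 4 → Set (BondConfig (Site d))) (g : Fin 4 ⊕ Fin 4 → γ)
    (hg : ∀ i j, g (Sum.inl i) = g (Sum.inr j) → j = 0 ∨ j = 1)
    (K₀ K₁ : Fin 4 → Set (Sym2 (Site d))) (h₀ : ∀ i, K₀ i ⊆ ω 0) (h₁ : ∀ i, K₁ i ⊆ ω 1)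
    (hA : ∀ i, Sum.elim K₀ K₁ i ∈ A i)
    (hd₀ : Pairwise fun i j => Disjoint (K₀ i) (K₀ j)) (hd₁ : Pairwise fun i j => Disjoint (K₁ i) (K₁ j))
    (hc₀ : ∀ j, Disjoint (K₁ 0) (K₀ j)) (hc₁ : ∀ j, Disjoint (K₁ 1) (K₀ j)) :
    ω ∈ genDisjOccGrouped A jwCfg g := by
  refine ⟨Sum.elim K₀ K₁, ?_, hA, ?_⟩
  · rintro (i | i)
    · exact h₀ i
    · exact h₁ i
  · rintro (i | i) (j | j) hij hrel
    · exact hd₀ fun h => hij (congrArg Sum.inl h)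
    · have hj : j = 0 ∨ j = 1 := by
        rcases hrel with h | h
        · exact absurd h (by simp [jwCfg])
        · exact hg i j h
      rcases hj with rfl | rfl
      · exact (hc₀ i).symm
      · exact (hc₁ i).symm
    · have hi : i = 0 ∨ i = 1 := by
        rcases hrel with h | h
        · exact absurd h (by simp [jwCfg])
        · exact hg j i h.symm
      rcases hi with rfl | rfl
      · exact hc₀ j
      · exact hc₁ j
    · exact hd₁ fun h => hij (congrArg Sum.inr h)

/-- The same from the `offBonds` containments of `jointWit` (`ω₀ ∖ {b₀} ⊆ ω₀`, `(ω₁)_{B(u)ᶜ} ⊆ ω₁`). [folklore] -/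
theorem mem_genDisjOccGrouped_of_tuple' {γ : Type*} {ω : Fin 2 → BondConfig (Site d)} {u v : Site d}
    (A : Fin 4 ⊕ Fin 4 → Set (BondConfig (Site d))) (g : Fin 4 ⊕ Fin 4 → γ)
    (hg : ∀ i j, g (Sum.inl i) = g (Sum.inr j) → j = 0 ∨ j = 1)
    (K₀ K₁ : Fin 4 → Set (Sym2 (Site d)))
    (h₀ : ∀ i, K₀ i ⊆ offBonds {s(u, v)} (ω 0)) (h₁ : ∀ i, K₁ i ⊆ offBonds (bondsAt {u}) (ω 1))
    (hA : ∀ i, Sum.elim K₀ K₁ i ∈ A i)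
    (hd₀ : Pairwise fun i j => Disjoint (K₀ i) (K₀ j)) (hd₁ : Pairwise fun i j => Disjoint (K₁ i) (K₁ j))
    (hc₀ : ∀ j, Disjoint (K₁ 0) (K₀ j)) (hc₁ : ∀ j, Disjoint (K₁ 1) (K₀ j)) :
    ω ∈ genDisjOccGrouped A jwCfg g :=
  mem_genDisjOccGrouped_of_tuple A g hg K₀ K₁ (fun i => (h₀ i).trans (offBonds_subset _ _))
    (fun i => (h₁ i).trans (offBonds_subset _ _)) hA hd₀ hd₁ hc₀ hc₁


/-! ### Class-level entry points (`clsSet` of `NobleBoundsN1Classes`) -/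

/-- **Class `(a,1)`**: on `jointWit ∩ clsSet u w t z a 1` the level-`1` witness tuple may be taken with
`K₁ 1 = {(t,z)}`. [cite: FitznerVanDerHofstad2017, §6.1 "(ii.) … one direct bond" and "b = 1" (arXiv:1506.07977v2 pp. 58–59)] -/
theorem exists_reroute₁_of_mem_cls {ω : Fin 2 → BondConfig (Site d)} {u v w z t x : Site d} {a : Fin 3}
    (h : ω ∈ jointWit u v w z t x ∩ clsSet u w t z a 1) :
    ∃ K₀ K₁ : Fin 4 → Set (Sym2 (Site d)),
      (∀ i, K₀ i ⊆ offBonds {s(u, v)} (ω 0)) ∧ (∀ i, K₁ i ⊆ offBonds (bondsAt {u}) (ω 1)) ∧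
        (∀ i, K₀ i ∈ jwLines₀ u w z i) ∧ (∀ i, K₁ i ∈ jwLines₁ v t z x i) ∧
        (Pairwise fun i j => Disjoint (K₀ i) (K₀ j)) ∧ (Pairwise fun i j => Disjoint (K₁ i) (K₁ j)) ∧
        (∀ j, Disjoint (K₁ 0) (K₀ j)) ∧ (∀ j, Disjoint (K₁ 1) (K₀ j)) ∧ (z ≠ t → ∀ j, s(t, z) ∉ K₀ j) ∧
      K₁ 1 = {s(t, z)} := by
  obtain ⟨hJ, -, htz, hb⟩ := h
  exact exists_reroute₁_of_mem_jointWit hJ (Ne.symm htz) hb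

/-- **Class `(1,b)`**: on `jointWit ∩ clsSet u w t z 1 b` the level-`0` witness tuple may be taken with
`K₀ 2 = {(u,w)}`. [cite: FitznerVanDerHofstad2017, §6.1 "(ii.) … one direct bond" and "a = 1" (arXiv:1506.07977v2 pp. 58–59)] -/
theorem exists_reroute₀_of_mem_cls {ω : Fin 2 → BondConfig (Site d)} {u v w z t x : Site d} {b : Fin 3}
    (h : ω ∈ jointWit u v w z t x ∩ clsSet u w t z 1 b) :
    ∃ K₀ K₁ : Fin 4 → Set (Sym2 (Site d)),
      (∀ i, K₀ i ⊆ offBonds {s(u, v)} (ω 0)) ∧ (∀ i, K₁ i ⊆ offBonds (bondsAt {u}) (ω 1)) ∧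
        (∀ i, K₀ i ∈ jwLines₀ u w z i) ∧ (∀ i, K₁ i ∈ jwLines₁ v t z x i) ∧
        (Pairwise fun i j => Disjoint (K₀ i) (K₀ j)) ∧ (Pairwise fun i j => Disjoint (K₁ i) (K₁ j)) ∧
        (∀ j, Disjoint (K₁ 0) (K₀ j)) ∧ (∀ j, Disjoint (K₁ 1) (K₀ j)) ∧ (z ≠ t → ∀ j, s(t, z) ∉ K₀ j) ∧
      K₀ 2 = {s(u, w)} := by
  obtain ⟨hJ, ⟨huw, hb⟩, -⟩ := h
  exact exists_reroute₀_of_mem_jointWit hJ (Ne.symm huw) hb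

/-- **Class `(1,1)`**: both re-routings at once. [cite: FitznerVanDerHofstad2017, §6.1 "(ii.)", "a = 1", "b = 1" (arXiv:1506.07977v2 pp. 58–59)] -/
theorem exists_reroute₀₁_of_mem_cls {ω : Fin 2 → BondConfig (Site d)} {u v w z t x : Site d}
    (h : ω ∈ jointWit u v w z t x ∩ clsSet u w t z 1 1) :
    ∃ K₀ K₁ : Fin 4 → Set (Sym2 (Site d)),
      (∀ i, K₀ i ⊆ offBonds {s(u, v)} (ω 0)) ∧ (∀ i, K₁ i ⊆ offBonds (bondsAt {u}) (ω 1)) ∧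
        (∀ i, K₀ i ∈ jwLines₀ u w z i) ∧ (∀ i, K₁ i ∈ jwLines₁ v t z x i) ∧
        (Pairwise fun i j => Disjoint (K₀ i) (K₀ j)) ∧ (Pairwise fun i j => Disjoint (K₁ i) (K₁ j)) ∧
        (∀ j, Disjoint (K₁ 0) (K₀ j)) ∧ (∀ j, Disjoint (K₁ 1) (K₀ j)) ∧ (z ≠ t → ∀ j, s(t, z) ∉ K₀ j) ∧
      K₀ 2 = {s(u, w)} ∧ K₁ 1 = {s(t, z)} := by
  obtain ⟨hJ, ⟨huw, hb₀⟩, htz, hb₁⟩ := h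
  exact exists_reroute₀₁_of_mem_jointWit hJ (Ne.symm huw) hb₀ (Ne.symm htz) hb₁


/-! ### Generic two-level form (arbitrary line index types; extra bond lines) -/

/-- The two-level configuration assignment for lines indexed by `ι₀ ⊕ ι₁` (level-`0` lines on coordinate `0`,
level-`1` lines on coordinate `1`); `jwCfg` is the case `ι₀ = ι₁ = Fin 4`. [cite: FitznerVanDerHofstad2017, (4.65) (arXiv:1506.07977v2 p. 43)] -/
theorem jwCfg_eq_sum_elim : jwCfg = Sum.elim (fun _ : Fin 4 => (0 : Fin 2)) (fun _ : Fin 4 => 1) := rfl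

/-- **Two-level witness families ⇒ grouped event, any index types.** Level-`0` witnesses `W₀ i ⊆ ω 0` and
level-`1` witnesses `W₁ j ⊆ ω 1`, pairwise disjoint on each level, and disjoint ACROSS levels whenever the two
lines share a group, put `ω` in `⊛^{grp}` of any lines containing them.  (Use: the eight lines of `jointWit`
together with the absorbed bond lines — `{b₀} ⊆ ω 0`, and in the classes `b = 1` / `a = 1` the second copy of
the class-`1` bond on the free coordinate — indexed by `Fin 6 ⊕ Fin 4`, `Fin 5 ⊕ Fin 5`, ….)
[cite: FitznerVanDerHofstad2017, §4.2 Def. 4.1 and §6.1 (arXiv:1506.07977v2 pp. 35, 58–59)] -/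
theorem mem_genDisjOccGrouped_twoLevel {ι₀ ι₁ γ : Type*} {ω : Fin 2 → BondConfig (Site d)}
    (A : ι₀ ⊕ ι₁ → Set (BondConfig (Site d))) (g : ι₀ ⊕ ι₁ → γ)
    (W₀ : ι₀ → Set (Sym2 (Site d))) (W₁ : ι₁ → Set (Sym2 (Site d)))
    (h₀ : ∀ i, W₀ i ⊆ ω 0) (h₁ : ∀ j, W₁ j ⊆ ω 1)
    (hA₀ : ∀ i, W₀ i ∈ A (Sum.inl i)) (hA₁ : ∀ j, W₁ j ∈ A (Sum.inr j))
    (hd₀ : Pairwise fun i i' => Disjoint (W₀ i) (W₀ i')) (hd₁ : Pairwise fun j j' => Disjoint (W₁ j) (W₁ j'))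
    (hc : ∀ i j, g (Sum.inl i) = g (Sum.inr j) → Disjoint (W₀ i) (W₁ j)) :
    ω ∈ genDisjOccGrouped A (Sum.elim (fun _ => (0 : Fin 2)) (fun _ => 1)) g := by
  refine ⟨Sum.elim W₀ W₁, ?_, ?_, ?_⟩
  · rintro (i | j)
    · exact h₀ i
    · exact h₁ j
  · rintro (i | j)
    · exact hA₀ i
    · exact hA₁ j
  · rintro (i | j) (i' | j') hne hrel
    · exact hd₀ fun h => hne (congrArg Sum.inl h)
    · rcases hrel with h | h
      · exact absurd h (by simp)
      · exact hc i j' h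
    · rcases hrel with h | h
      · exact absurd h (by simp)
      · exact (hc i' j h.symm).symm
    · exact hd₁ fun h => hne (congrArg Sum.inr h)

/-- The pivotal bond `b₀ = (u,v)` is off every level-`0` witness of `jointWit`. [folklore] -/
theorem not_mem_of_subset_offBonds_singleton {u v : Site d} {α : BondConfig (Site d)} {K : Set (Sym2 (Site d))}
    (hK : K ⊆ offBonds {s(u, v)} α) : s(u, v) ∉ K :=
  fun h => (hK h).2 rfl

/-- A bond at `u` (`b₀ = (u,v)`, or the class-`a = 1` bond `(u,w)`) is off every level-`1` witness of `jointWit`.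
[folklore] -/
theorem not_mem_of_subset_offBonds_bondsAt {u y : Site d} {β : BondConfig (Site d)} {K : Set (Sym2 (Site d))}
    (hK : K ⊆ offBonds (bondsAt {u}) β) : s(u, y) ∉ K :=
  fun h => not_mem_offBonds_bondsAt_self u y β (hK h)

/-- Disjointness of a singleton bond line from a witness, from non-membership. [folklore] -/
theorem disjoint_singleton_of_not_mem {e : Sym2 (Site d)} {K : Set (Sym2 (Site d))} (h : e ∉ K) :
    Disjoint ({e} : Set (Sym2 (Site d))) K :=
  Set.disjoint_singleton_left.2 h

end Literature.Probability.FitznerVanDerHofstad2017
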